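import Literature.NumberTheory.Automorphic.ArthurClozelCuspidalDescentGLOneClassField
import Literature.NumberTheory.Automorphic.ArthurClozelCuspidalDescentAssembly
import Literature.NumberTheory.Automorphic.ExistsClassFieldCharacterHolds
import Literature.NumberTheory.Automorphic.ClassFieldCharacterFrobenius
import Literature.NumberTheory.Automorphic.RankinSelbergTowerFiniteness
import Literature.NumberTheory.Automorphic.PairLFunctionPolesGLOneProofs
import Literature.NumberTheory.Automorphic.PairLFunctionPolesGLOneDedekindProofs
import Literature.NumberTheory.Automorphic.StrongMultiplicityOneGLOne
import Literature.NumberTheory.GaloisRepresentations.HeckeCharacterWeakApproximation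
import HarnessLib

/-!
# Arthur–Clozel, Ch. 3, Thm. 4.2 (d): the class-field inputs discharged, and rank one in full
(proof file)

Topic `NumberTheory/Automorphic`; namespace `Literature.NumberTheory.Automorphic`. Proof file
(theorems only: no definition, no named fact, no instance) continuing
`ArthurClozelCuspidalDescentGLOne`, `ArthurClozelCuspidalDescentGLOneClassField` and
`ArthurClozelCuspidalDescentAssembly` under the named facts
`ArthurClozel1989_exists_cuspidal_descent_of_isGalStable` (`AutomorphicGaloisConj`: J. Arthur,
L. Clozel, *Simple algebras, base change, and the advanced theory of the trace formula*, Ann. of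
Math. Stud. 120 (1989), Ch. 3, **Thm. 4.2 (d)**, existence clause: "Assume `Π` is cuspidal,
`Π ≅ Π ∘ σ`. Then there is `π` cuspidal lifting to `Π`") and `ArthurClozel1989_cuspidal_descent`
(`ArthurClozelBaseChange`: Thm. 4.2 (d) in full, "all such `π` are conjugate by tensor product by a
power of `η`; they satisfy `π ≇ π ⊗ η`"). Held copy of the source:
`book:arthur1989-simple-algebras-base-change-advanced-theory-trace`, PDF chunks 173 (statement,
book p. 203) and 177 (proof of (d), p. 204).

Since those files were written the tree acquired the class field theory they took as hypotheses:
the class-field character exists (`exists_isClassFieldCharacter_holds`,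
`ExistsClassFieldCharacterHolds`: Tate's Main Theorem (B), Cassels–Fröhlich Ch. VII §5.1, for
cyclic `E/F`, with the idelic norm index `[𝕀_F : F^× N 𝕀_E] = [E : F]`,
`index_normGroup_eq_finrank_of_isCyclic`), its values at unramified uniformizers are primitive
`f_v`-th roots of unity (`IsClassFieldCharacter.eventually_isPrimitiveRoot_valueAtUniformizer`,
`ClassFieldCharacterFrobenius`), and Jacquet–Shalika (2.1) is a theorem
(`JacquetShalika1981_multipliable_partialPairL_holds`, `RankinSelbergTowerFiniteness`). This file
feeds them in. Everything is **proved**: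

* `herbrand_h1_top_principalIdeles_eq_one'` — **`H¹(Gal(E/F), C_E) = 0`** for `E/F` cyclic
  (`#Ĥ⁻¹(⟨σ⟩; J_E, Eˣ) = 1`; Cassels–Fröhlich VII Thm. 9.1 (2)), unconditionally, and its element
  form `exists_eq_mul_smul_div_of_ideleGalNorm_mem_principalIdeles'` (an idele with principal Galois
  norm is `p · σz/z`).
* `HeckeCharacter.exists_baseChange_eq_of_forall_smul_eq`,
  `HeckeCharacter.exists_baseChange_eq_iff_forall_smul_eq` — **descent for `GL(1)`**: for `E/F`
  Galois of prime degree, a Hecke character of `E` is a base change `μ ∘ N_{E/F}` iff it is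
  `Gal(E/F)`-invariant, unconditionally.
* `ArthurClozel1989_exists_cuspidal_descent_of_isGalStable.rank_one` — **the named fact (d),
  existence clause, for `n = 1`, unconditionally** (the case `n = 0` is
  `arthurClozel1989_exists_cuspidal_descent_of_isGalStable_zero` of `AutomorphicGaloisConjProofs`;
  for `n ≥ 2` the printed proof is the trace-formula identity (4.1) = (4.2), Ch. 2 (17.8), which
  the tree does not have).
* `arthurClozel1989_cuspidal_descent_of_exists'`, `arthurClozel1989_cuspidal_descent_iff_exists'` —
  **(d) in full ⟺ its existence clause**, for every `n`, granting only Jacquet–Shalika (2.2), (2.3)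
  over `F`, (2.3) over `E` and multiplicity one on `L²_cusp(GL_n(𝔸_F))` (named facts of
  `PairLFunctionPoles`, `AutomorphicGLn`).
* The `GL(1)` dictionary completed: `GLOne.eigenvalue_twist`,
  `CuspidalAutomorphicRepGL.heckeCharacter_twistByChar` (**`χ_{π ⊗ χ} = χ χ_π`**),
  `CuspidalAutomorphicRepGL.heckeCharacter_eq_baseChange_of_isWeakBaseChangeLift` and
  `…isWeakBaseChangeLift_iff_heckeCharacter_eq_baseChange` (**relation (1.1) for cuspidal
  `π, Π` on `GL_1` is `χ_Π = χ_π ∘ N_{E/F}`**, by rigidity of Hecke characters, Cassels–Fröhlich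
  VII Prop. 4.1), `HeckeCharacter.isTrivialOnNormGroup_iff_baseChange_eq_one`, and
  `IsClassFieldCharacter.exists_eq_pow_of_isTrivialOnNormGroup` (**for `ℓ` prime the characters
  of `𝔸^*/F^* N(𝔸_E^*)` are the powers `η^i`, `i < ℓ`** — Thm. 3.1 of op. cit. in rank one).
* `arthurClozel1989_cuspidal_descent_one` — **the named fact `ArthurClozel1989_cuspidal_descent`
  (Thm. 4.2 (d), all three clauses) for `n = 1`, unconditionally**: existence by `rank_one`;
  `π ⊗ η ≠ π` as `η ≠ 1`; every cuspidal descent `π'` of `Π` is `π ⊗ η^i` since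
  `χ_{π'} χ_π⁻¹` is trivial on `F^× N(𝔸_E^×)`, plus multiplicity one for `GL_1`
  (`CuspidalAutomorphicRepGL.eq_of_heckeCharacter_eq`, proved by ergodicity). Also the `η`-free
  packaging `arthurClozel1989_cuspidal_descent_one_of_character` via the `L`-function road of the
  Assembly file, where only (2.2) for `GL_1` over `F` (Hecke–Tate) remains an input.
* The siblings in rank one: `CuspidalAutomorphicRepGL.twistByFiniteOrderChar_ne_of_isClassFieldCharacter_one`
  (`π ⊗ η ≠ π` on `GL_1`), hence **Thm. 4.2 (b) for `n = 1`** in both renderings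
  (`arthurClozel1989_inducedLift_of_twist_eq_one`, `arthurClozel1989_dvd_of_twist_eq_one`:
  vacuous, the hypothesis `π ⊗ η = π` being impossible); and **Thm. 3.1 (fibres of base change)
  for `n = 1` and `E/F` cyclic of any degree, unconditionally**
  (`arthurClozel1989_fibres_of_baseChange_one`: `(t_{π',v})^{f_v} = (t_{π,v})^{f_v}` a.e. forces
  `χ_{π'} χ_π⁻¹ ∘ N_{E/F} = 1`, i.e. `π' = π ⊗ χ` with `χ` trivial on `F^× N(𝔸_E^×)`). With
  `arthurClozel1989_weakLifting_cuspidal_one` (`Sweep1BaseChangeGLOneAssembly`, Thm. 4.2 (a)) the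
  whole of Thm. 3.1 and Thm. 4.2 (a), (b), (d) of op. cit. is now a theorem of the tree in rank
  one; (e) for `m = 1` (automorphic induction `GL_1/E → GL_ℓ/F`) is of a different nature.

## References

* J. Arthur, L. Clozel, *Simple algebras, base change, and the advanced theory of the trace
  formula*, Ann. of Math. Stud. 120 (1989), Ch. 3, §1 Def. 1.1, Thm. 3.1, Thm. 4.2 (d) and its
  proof (pp. 203–204). [ArthurClozelAMS120]
* J. W. S. Cassels, A. Fröhlich (eds.), *Algebraic Number Theory* (1967), Ch. VII (Tate), §4
  Prop. 4.1, §5.1 Main Theorem (B), §9 Thm. 9.1. [CasselsFrohlichANT1967]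
* H. Jacquet, J. Shalika, *On Euler products and the classification of automorphic forms I, II*,
  Amer. J. Math. 103 (1981). [JacquetShalikaAJM1981]
-/

noncomputable section

open scoped NNReal
open NumberField IsDedekindDomain MeasureTheory Filter Topology

namespace Literature.NumberTheory.Automorphic

open Literature.NumberTheory.GaloisRepresentations AdelicGroupData

/-! ### Class field theory discharged: `H¹(Gal(E/F), C_E) = 0`, `GL(1)` descent, (d) for `n = 1` -/

section ClassField

variable {F E : Type} [Field F] [NumberField F] [Field E] [NumberField E] [Algebra F E]

/-- **`H¹(Gal(E/F), C_E) = 0` for a cyclic extension of number fields** (Tate, Cassels–Fröhlich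
Ch. VII, Thm. 9.1 (2)), in Herbrand-quotient form `#Ĥ⁻¹(⟨σ⟩; J_E, Eˣ) = 1`, now unconditional:
`herbrand_h1_top_principalIdeles_eq_one` fed with the tree's discharge
`exists_isClassFieldCharacter_holds` of the class-field character (Cassels–Fröhlich VII §5.1 (B)).
[cite: CasselsFrohlichANT1967, Ch. VII §9 Thm. 9.1 (2)] -/
theorem herbrand_h1_top_principalIdeles_eq_one' [IsGalois F E] {σ : E ≃ₐ[F] E}
    (hσ : ∀ τ : E ≃ₐ[F] E, τ ∈ Subgroup.zpowers σ) :
    Herbrand.h1 σ ⊤ (principalIdeles E) = 1 :=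
  herbrand_h1_top_principalIdeles_eq_one hσ exists_isClassFieldCharacter_holds

/-- **Hilbert 90 for idele classes of a cyclic extension, element form, unconditional**: for
`Gal(E/F) = ⟨σ⟩`, an idele `y` of `E` whose Galois norm is principal is `p · (σ z / z)` with `p`
principal. [cite: CasselsFrohlichANT1967, Ch. VII §9 Thm. 9.1 (2)] -/
theorem exists_eq_mul_smul_div_of_ideleGalNorm_mem_principalIdeles' [IsGalois F E]
    {σ : E ≃ₐ[F] E} (hσ : ∀ τ : E ≃ₐ[F] E, τ ∈ Subgroup.zpowers σ) {y : ideleGroup E}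
    (hy : AdeleRing.ideleGalNorm F E y ∈ principalIdeles E) :
    ∃ p ∈ principalIdeles E, ∃ z : ideleGroup E, y = p * (σ • z / z) :=
  exists_eq_mul_smul_div_of_ideleGalNorm_mem_principalIdeles hσ exists_isClassFieldCharacter_holds hy

/-- **Descent for `GL(1)` (base change for idele class characters is onto the `Gal`-invariant
characters), unconditional**: for `E/F` Galois of prime degree, every `Gal(E/F)`-invariant Hecke
character `χ` of `E` is `μ ∘ N_{E/F}` for a Hecke character `μ` of `F`
(`HeckeCharacter.exists_baseChange_eq_of_forall_smul_of_classField` with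
`exists_isClassFieldCharacter_holds`). This is Arthur–Clozel's Thm. 4.2 (d) (existence of a
descent) for `n = 1` at the level of characters. [cite: ArthurClozelAMS120, Ch. 3, Thm. 4.2 (d)] -/
theorem _root_.Literature.NumberTheory.GaloisRepresentations.HeckeCharacter.exists_baseChange_eq_of_forall_smul_eq
    [IsGalois F E]
    (hℓ : (Module.finrank F E).Prime) (χ : HeckeCharacter E)
    (hχ : ∀ (τ : E ≃ₐ[F] E) (y : ideleGroup E), χ (τ • y) = χ y) :
    ∃ μ : HeckeCharacter F, μ.baseChange E = χ :=
  HeckeCharacter.exists_baseChange_eq_of_forall_smul_of_classField hℓ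
    exists_isClassFieldCharacter_holds χ hχ

/-- **The image of base change for `GL(1)`**: for `E/F` Galois of prime degree, a Hecke character
of `E` is a base change `μ ∘ N_{E/F}` iff it is `Gal(E/F)`-invariant
(`HeckeCharacter.baseChange_smul` and `HeckeCharacter.exists_baseChange_eq_of_forall_smul_eq`).
[cite: ArthurClozelAMS120, Ch. 3, Thm. 4.2 (a), (d) (rank one)] -/
theorem _root_.Literature.NumberTheory.GaloisRepresentations.HeckeCharacter.exists_baseChange_eq_iff_forall_smul_eq
    [IsGalois F E]
    (hℓ : (Module.finrank F E).Prime) (χ : HeckeCharacter E) :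
    (∃ μ : HeckeCharacter F, μ.baseChange E = χ) ↔
      ∀ (τ : E ≃ₐ[F] E) (y : ideleGroup E), χ (τ • y) = χ y := by
  refine ⟨?_, χ.exists_baseChange_eq_of_forall_smul_eq hℓ⟩
  rintro ⟨μ, rfl⟩ τ y
  exact μ.baseChange_smul E τ y

/-- **Arthur–Clozel, Ch. 3, Thm. 4.2 (d), existence clause, in rank `n = 1` — unconditionally.**
The named fact `ArthurClozel1989_exists_cuspidal_descent_of_isGalStable (n := 1)`: for `E/F`
Galois of prime degree, every `Gal(E/F)`-stable cuspidal automorphic representation of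
`GL_1(𝔸_E)` is the weak base-change lift of a cuspidal automorphic representation of `GL_1(𝔸_F)`
(`arthurClozel1989_exists_cuspidal_descent_of_isGalStable_one_of_classField`, its class-field
input `exists_isClassFieldCharacter` being the tree's theorem `exists_isClassFieldCharacter_holds`).
In print the proof of (d) for general `n` is the trace-formula comparison (4.1) = (4.2) of
op. cit.; for `n = 1` it is base change for idele class characters (class field theory), which is
the road taken here. [cite: ArthurClozelAMS120, Ch. 3, Thm. 4.2 (d)] -/
theorem ArthurClozel1989_exists_cuspidal_descent_of_isGalStable.rank_one :
    ArthurClozel1989_exists_cuspidal_descent_of_isGalStable (n := 1) (F := F) (E := E) :=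
  arthurClozel1989_exists_cuspidal_descent_of_isGalStable_one_of_classField
    exists_isClassFieldCharacter_holds

end ClassField

/-! ### Thm. 4.2 (d) in full from its existence clause: the analytic inputs that remain -/

section Assembly

variable {n : ℕ} {F E : Type} [Field F] [NumberField F] [Field E] [NumberField E] [Algebra F E]

/-- **The named fact `ArthurClozel1989_cuspidal_descent` (Thm. 4.2 (d) with the class-field
character `η`) from its existence clause `ArthurClozel1989_exists_cuspidal_descent_of_isGalStable`**,
granting only Jacquet–Shalika (2.2), (2.3) over `F`, (2.3) over `E` and multiplicity one on
`L²_cusp(GL_n(𝔸_F))`: the remaining inputs of `arthurClozel1989_cuspidal_descent_of_exists`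
(`ArthurClozelCuspidalDescentAssembly`) are now theorems of the tree — (2.1), the absolute
convergence of `L^S(s, π × π')` on `Re s > 1` (`JacquetShalika1981_multipliable_partialPairL_holds`,
`RankinSelbergTowerFiniteness`), and the local behaviour of class-field characters, "`η(ϖ_v)` is a
primitive `f_v`-th root of unity for almost all `v`" (Arthur–Clozel p. 201, "`ζ_v` is a root of
unity of order `f_v`"; `IsClassFieldCharacter.eventually_isPrimitiveRoot_valueAtUniformizer`,
`ClassFieldCharacterFrobenius`, from Artin reciprocity for characters).
[cite: ArthurClozelAMS120, Ch. 3, Thm. 4.2 (d) and its proof (§4)] -/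
theorem arthurClozel1989_cuspidal_descent_of_exists' [FiniteDimensional F E]
    (hex : ArthurClozel1989_exists_cuspidal_descent_of_isGalStable (n := n) (F := F) (E := E))
    (h22F : ∀ (μ : Measure (gl n F).automorphicQuotient) [(gl n F).IsAutomorphicMeasure μ],
      JacquetShalika1981_partialPairL_at_one_of_ne_conj (n := n) (K := F) (μ := μ))
    (h23F : ∀ (μ : Measure (gl n F).automorphicQuotient) [(gl n F).IsAutomorphicMeasure μ],
      JacquetShalika1981_partialPairL_pole_of_eq_conj (n := n) (K := F) (μ := μ))
    (hm : ∀ (μ : Measure (gl n F).automorphicQuotient) [(gl n F).IsAutomorphicMeasure μ],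
      multiplicity_one_gl n F μ)
    (h23E : ∀ (ν : Measure (gl n E).automorphicQuotient) [(gl n E).IsAutomorphicMeasure ν],
      JacquetShalika1981_partialPairL_pole_of_eq_conj (n := n) (K := E) (μ := ν)) :
    ArthurClozel1989_cuspidal_descent n F E := by
  intro _ hn hℓ η hη ν _ hν Q hQ
  obtain ⟨μ, hμ, P, hP, hne, hall⟩ := arthurClozel1989_cuspidal_descent_of_exists_of_character
    hex (fun _ _ => JacquetShalika1981_multipliable_partialPairL_holds) h22F h23F hm
    JacquetShalika1981_multipliable_partialPairL_holds (h23E ν) hn hℓ hη.isFiniteOrder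
    (hη.eventually_isPrimitiveRoot_valueAtUniformizer hℓ) hν Q hQ
  refine ⟨μ, hμ, P, hP, hne, fun P' hP' => ?_⟩
  obtain ⟨i, -, hi⟩ := hall P' hP'
  exact ⟨i, hi⟩

/-- **(d) ⟺ its existence clause**, granting Jacquet–Shalika (2.2), (2.3) over `F`, (2.3) over `E`
and multiplicity one on `L²_cusp(GL_n(𝔸_F))` (the class-field inputs of
`arthurClozel1989_cuspidal_descent_iff_exists` discharged by `exists_isClassFieldCharacter_holds`
and `IsClassFieldCharacter.eventually_isPrimitiveRoot_valueAtUniformizer`, the convergence (2.1) by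
`JacquetShalika1981_multipliable_partialPairL_holds`). [cite: ArthurClozelAMS120, Ch. 3, Thm. 4.2 (d)] -/
theorem arthurClozel1989_cuspidal_descent_iff_exists' [FiniteDimensional F E]
    (h22F : ∀ (μ : Measure (gl n F).automorphicQuotient) [(gl n F).IsAutomorphicMeasure μ],
      JacquetShalika1981_partialPairL_at_one_of_ne_conj (n := n) (K := F) (μ := μ))
    (h23F : ∀ (μ : Measure (gl n F).automorphicQuotient) [(gl n F).IsAutomorphicMeasure μ],
      JacquetShalika1981_partialPairL_pole_of_eq_conj (n := n) (K := F) (μ := μ))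
    (hm : ∀ (μ : Measure (gl n F).automorphicQuotient) [(gl n F).IsAutomorphicMeasure μ],
      multiplicity_one_gl n F μ)
    (h23E : ∀ (ν : Measure (gl n E).automorphicQuotient) [(gl n E).IsAutomorphicMeasure ν],
      JacquetShalika1981_partialPairL_pole_of_eq_conj (n := n) (K := E) (μ := ν)) :
    ArthurClozel1989_cuspidal_descent n F E ↔
      ArthurClozel1989_exists_cuspidal_descent_of_isGalStable (n := n) (F := F) (E := E) :=
  ⟨arthurClozel1989_exists_cuspidal_descent_of_isGalStable_of_descent'
      exists_isClassFieldCharacter_holds,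
    fun hex => arthurClozel1989_cuspidal_descent_of_exists' hex h22F h23F hm h23E⟩

end Assembly

/-! ### The `GL(1)` dictionary: Hecke characters of twists and of weak base-change lifts -/

section GLOneTwist

variable {K : Type} [Field K] [NumberField K]
  {μ : Measure (gl 1 K).automorphicQuotient} [(gl 1 K).IsAutomorphicMeasure μ]
  {W : ContRepresentation.ClosedSubrep ((gl 1 K).rightRegular μ)}

/-- **The eigencharacter of a twist**: for an irreducible `W ≤ L²(GL_1)` and a unitary automorphic
character `ψ` of `GL_1(𝔸_K)`, `R(g)` acts on `M_ψ(W) = {ψ̄ f : f ∈ W}` by `ψ(g)⁻¹ ω_W(g)`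
(`M_ψ (R(g) f) = ψ(g) R(g) (M_ψ f)`, `isTwistedEquivariant_twistEquiv`). [folklore] -/
theorem GLOne.eigenvalue_twist (hW : W.toContRep.IsTopIrreducible) (ψ : (gl 1 K).AutomorphicCharacter)
    (hW' : (W.twist ψ).toContRep.IsTopIrreducible) (g : (gl 1 K).Adelic) :
    GLOne.eigenvalue hW' g = ((ψ g : ℂˣ) : ℂ)⁻¹ * GLOne.eigenvalue hW g := by
  obtain ⟨f, hf⟩ := GLOne.exists_ne_zero hW
  have hf' : W.twistEquiv ψ f ≠ 0 := fun h =>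
    hf ((W.twistEquiv ψ).injective (by rw [h, map_zero]))
  have h1 := W.isTwistedEquivariant_twistEquiv ψ g f
  rw [GLOne.toContRep_apply_eq_eigenvalue_smul hW g f, map_smul,
    GLOne.toContRep_apply_eq_eigenvalue_smul hW' g, smul_smul] at h1
  have h2 : GLOne.eigenvalue hW g = ((ψ g : ℂˣ) : ℂ) * GLOne.eigenvalue hW' g :=
    smul_left_injective ℂ hf' h1
  rw [h2, ← mul_assoc, inv_mul_cancel₀ (Units.ne_zero _), one_mul]

/-- **The Hecke character of a twist, rank one: `χ_{π ⊗ χ} = χ · χ_π`.** For a cuspidal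
`π ≤ L²_cusp(GL_1(𝔸_K))` (the line of the unitary character `χ_π`) and a unitary Hecke character
`χ` trivial on `ℝ_{>0}`, the twist `π ⊗ χ` (`twistByChar`: the subspace `{(χ̄ ∘ det)⁻¹ f : f ∈ π}`,
realising `π ⊗ (χ ∘ det)`) has Hecke character `χ χ_π` (`GLOne.eigenvalue_twist` at the scalar
`x ∈ 𝔸_Kˣ = GL_1(𝔸_K)`, `det x = x`). [folklore] -/
theorem CuspidalAutomorphicRepGL.heckeCharacter_twistByChar (P : CuspidalAutomorphicRepGL 1 K μ)
    (χ : HeckeCharacter K) (hχ : χ.IsUnitary) (hχ₀ : ∀ t, χ (posRealIdele K t) = 1) :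
    (P.twistByChar χ hχ hχ₀).heckeCharacter = χ * P.heckeCharacter := by
  refine HeckeCharacter.ext fun x => Units.ext ?_
  have hdet : Matrix.GeneralLinearGroup.det (Matrix.GeneralLinearGroup.scalar (Fin 1) x) = x :=
    Units.ext (by simp)
  calc (((P.twistByChar χ hχ hχ₀).heckeCharacter x : ℂˣ) : ℂ)
      = GLOne.eigenvalue (P.twistByChar χ hχ hχ₀).isTopIrreducible
          (Matrix.GeneralLinearGroup.scalar (Fin 1) x) := rfl
    _ = (((detChar (n := 1) χ hχ hχ₀)⁻¹ (Matrix.GeneralLinearGroup.scalar (Fin 1) x) : ℂˣ) : ℂ)⁻¹ *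
          GLOne.eigenvalue P.isTopIrreducible (Matrix.GeneralLinearGroup.scalar (Fin 1) x) :=
        GLOne.eigenvalue_twist P.isTopIrreducible _ _ _
    _ = ((χ x : ℂˣ) : ℂ) * ((P.heckeCharacter x : ℂˣ) : ℂ) := by
        rw [AutomorphicCharacter.coe_inv_apply, inv_inv, detChar_apply, hdet]; rfl
    _ = (((χ * P.heckeCharacter) x : ℂˣ) : ℂ) := by
        rw [HeckeCharacter.mul_apply, Units.val_mul]

/-- `χ_{π ⊗ χ} = χ χ_π` for the twist by a character of finite order (`twistByFiniteOrderChar`).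
[folklore] -/
theorem CuspidalAutomorphicRepGL.heckeCharacter_twistByFiniteOrderChar
    (P : CuspidalAutomorphicRepGL 1 K μ) (χ : HeckeCharacter K) (hχ : χ.IsFiniteOrder) :
    (P.twistByFiniteOrderChar χ hχ).heckeCharacter = χ * P.heckeCharacter := by
  rw [CuspidalAutomorphicRepGL.twistByFiniteOrderChar_eq]
  exact P.heckeCharacter_twistByChar χ _ _

end GLOneTwist

section GLOneLift

variable {F E : Type} [Field F] [NumberField F] [Field E] [NumberField E] [Algebra F E]
  {μ : Measure (gl 1 F).automorphicQuotient} [(gl 1 F).IsAutomorphicMeasure μ]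
  {ν : Measure (gl 1 E).automorphicQuotient} [(gl 1 E).IsAutomorphicMeasure ν]

/-- **Relation (1.1) in rank one read on Hecke characters: if `Π` is a weak base-change lift of
`π` (`π`, `Π` cuspidal on `GL_1` over `F`, `E`), then `χ_Π = χ_π ∘ N_{E/F}`.** At almost every `w`
(`π` with an honest Satake parameter `{χ_π(ϖ_v)}` below `w`, `E/F` unramified at `w`, both
characters unramified at `w`) the image `ϖ'` of `ϖ_v` is a uniformizer of `E_w`,
`t_{Π,w} = {χ_Π(ϖ')}` (`GLOne.hasSatakeParameterAt_singleton`) and (1.1) reads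
`χ_Π(ϖ') = χ_π(ϖ_v)^{f(w|v)} = (χ_π ∘ N)(ϖ')` (`HeckeCharacter.baseChange_localUnits`); two Hecke
characters agreeing at almost all uniformizers are equal
(`HeckeCharacter.ext_of_eventually_valueAtUniformizer_eq`, Cassels–Fröhlich VII Prop. 4.1). The
converse is `isWeakBaseChangeLift_of_heckeCharacter_eq_baseChange`
(`ArthurClozelCuspidalDescentGLOne`). [cite: ArthurClozelAMS120, Ch. 3, §1 Def. 1.1 and (1.1)] -/
theorem CuspidalAutomorphicRepGL.heckeCharacter_eq_baseChange_of_isWeakBaseChangeLift [IsGalois F E]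
    {P : CuspidalAutomorphicRepGL 1 F μ} {Q : CuspidalAutomorphicRepGL 1 E ν}
    (h : IsWeakBaseChangeLift P.1 Q.1) : Q.heckeCharacter = P.heckeCharacter.baseChange E := by
  classical
  obtain ⟨𝔫, -, hP⟩ := exists_hasSatakeParameterAt_cofinite_holds (n := 1) (K := F) (μ := μ) P
  obtain ⟨𝔑, -, hQK⟩ := GLOne.exists_level_eigenvalue_eq_one Q.isTopIrreducible
  have hw := h 𝔫 𝔑
  have h2 : ∀ᶠ w : HeightOneSpectrum (𝓞 E) in cofinite,
      ∃ (ϖ : ((w.under (𝓞 F)).adicCompletion F)ˣ) (α : Multiset ℂ),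
        HasSatakeParameterAt P.1 (principalCongruenceLevel 1 F 𝔫) (w.under (𝓞 F)) ϖ α :=
    (tendsto_under_cofinite (𝓞 F)).eventually hP
  have hurQ : ∀ᶠ w : HeightOneSpectrum (𝓞 E) in cofinite, Q.heckeCharacter.IsUnramifiedAt w :=
    Q.heckeCharacter.finite_ramifiedPlaces_iff.1 (HeckeCharacter.finite_ramifiedPlaces_holds _)
  have hurP : ∀ᶠ w : HeightOneSpectrum (𝓞 E) in cofinite,
      (P.heckeCharacter.baseChange E).IsUnramifiedAt w :=
    (P.heckeCharacter.baseChange E).finite_ramifiedPlaces_iff.1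
      (HeckeCharacter.finite_ramifiedPlaces_holds _)
  refine HeckeCharacter.ext_of_eventually_valueAtUniformizer_eq ?_
  filter_upwards [hw, h2, eventually_ramificationIdx_eq_one F E, hurQ, hurP]
    with w hw1 hw2 hw4 huQ huP
  obtain ⟨ϖ, α, hα⟩ := hw2
  -- the uniformizer `ϖ' = ϖ_v ∈ E_w` (`v = w ∩ 𝓞 F`, `e(w|v) = 1`)
  haveI iw : w.asIdeal.LiesOver (w.under (𝓞 F)).asIdeal := ⟨rfl⟩
  obtain ⟨c, hc, -⟩ := exists_localUnitsAbove E (w.under (𝓞 F)) ϖ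
  have he' : (w.under (𝓞 F)).asIdeal.ramificationIdx' w.asIdeal = 1 := by
    rw [Ideal.ramificationIdx'_eq_ramificationIdx (w.under (𝓞 F)).asIdeal w.asIdeal
      (w.under (𝓞 F)).ne_bot, hw4]
  have heIn : (w.under (𝓞 F)).asIdeal.ramificationIdxIn (𝓞 E) = 1 := by
    rw [Ideal.ramificationIdxIn_eq_ramificationIdx (w.under (𝓞 F)).asIdeal w.asIdeal (E ≃ₐ[F] E),
      hw4]
  have hfIn : (w.under (𝓞 F)).asIdeal.inertiaDegIn (𝓞 E) = w.asIdeal.inertiaDeg (𝓞 F) :=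
    Ideal.inertiaDegIn_eq_inertiaDeg (w.under (𝓞 F)).asIdeal w.asIdeal (E ≃ₐ[F] E)
  have hϖ' : Valued.v ((c w : (w.adicCompletion E)ˣ) : w.adicCompletion E) =
      WithZero.exp (-1 : ℤ) := by
    rw [hc w rfl, valued_adicCompletionOfLiesOver, he', pow_one, hα.1]
  -- (1.1) at `w`: `{χ_Π(ϖ')} = {χ_π(ϖ_v)} ^ f`
  have hrel := hw1 ϖ (c w) α _ hα (GLOne.hasSatakeParameterAt_singleton Q.isTopIrreducible hQK w hϖ')
  rw [hα.eq_singleton_heckeCharacter P.isTopIrreducible, Multiset.map_singleton,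
    Multiset.singleton_inj] at hrel
  have hbc : ((P.heckeCharacter.baseChange E (localUnits w (c w)) : ℂˣ) : ℂ) =
      ((GLOne.heckeCharacter P.isTopIrreducible (localUnits (w.under (𝓞 F)) ϖ) : ℂˣ) : ℂ) ^
        w.asIdeal.inertiaDeg (𝓞 F) := by
    rw [HeckeCharacter.baseChange_localUnits E P.heckeCharacter (w.under (𝓞 F)) ϖ c hc rfl, heIn,
      one_mul, hfIn, Units.val_pow_eq_pow_val]
    rfl
  rw [← HeckeCharacter.localComponent_eq_valueAtUniformizer huQ hϖ',
    ← HeckeCharacter.localComponent_eq_valueAtUniformizer huP hϖ', HeckeCharacter.localComponent_apply,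
    HeckeCharacter.localComponent_apply, hbc]
  exact hrel

/-- **(1.1) in rank one ⟺ `χ_Π = χ_π ∘ N_{E/F}`.** [cite: ArthurClozelAMS120, Ch. 3, §1 Def. 1.1 and (1.1)] -/
theorem CuspidalAutomorphicRepGL.isWeakBaseChangeLift_iff_heckeCharacter_eq_baseChange [IsGalois F E]
    (P : CuspidalAutomorphicRepGL 1 F μ) (Q : CuspidalAutomorphicRepGL 1 E ν) :
    IsWeakBaseChangeLift P.1 Q.1 ↔ Q.heckeCharacter = P.heckeCharacter.baseChange E :=
  ⟨CuspidalAutomorphicRepGL.heckeCharacter_eq_baseChange_of_isWeakBaseChangeLift,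
    isWeakBaseChangeLift_of_heckeCharacter_eq_baseChange P Q⟩

end GLOneLift

/-! ### Characters of `𝔸_Fˣ / F^× N(𝔸_E^×)` are the powers of the class-field character -/

section NormGroupCharacters

variable {F E : Type} [Field F] [NumberField F] [Field E] [NumberField E] [Algebra F E]

/-- `χ` is trivial on `F^× N(𝔸_E^×)` as soon as `χ ∘ N_{E/F} = 1`
(`isTrivialOnNormGroup_iff_forall_ideleRelNorm`). [folklore] -/
theorem _root_.Literature.NumberTheory.GaloisRepresentations.HeckeCharacter.isTrivialOnNormGroup_iff_baseChange_eq_one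
    [IsGalois F E]
    (χ : HeckeCharacter F) : χ.IsTrivialOnNormGroup E ↔ χ.baseChange E = 1 := by
  rw [χ.isTrivialOnNormGroup_iff_forall_ideleRelNorm E]
  refine ⟨fun h => HeckeCharacter.ext fun y => ?_, fun h y => ?_⟩
  · rw [HeckeCharacter.baseChange_apply, h y, HeckeCharacter.one_apply]
  · rw [← HeckeCharacter.baseChange_apply, h, HeckeCharacter.one_apply]

/-- For a Galois extension `E ≠ F` with cyclic group (so `[𝕀_F : F^× N 𝕀_E] = [E : F] > 1`,
`index_normGroup_eq_finrank_of_isCyclic`) some idele lies outside the norm group. [folklore] -/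
theorem exists_not_mem_normGroup [IsGalois F E] [IsCyclic (E ≃ₐ[F] E)]
    (h1 : 1 < Module.finrank F E) : ∃ x : ideleGroup F, x ∉ normGroup F E := by
  by_contra! hall
  have htop : normGroup F E = ⊤ := eq_top_iff.2 fun x _ => hall x
  have hidx := index_normGroup_eq_finrank_of_isCyclic (F := F) (E := E)
  rw [htop, Subgroup.index_top] at hidx
  exact h1.ne hidx

/-- **The characters of `𝔸_Fˣ / F^× N(𝔸_E^×)` for `E/F` cyclic of prime degree `ℓ` are
`1, η, …, η^{ℓ-1}`**, `η` any class-field character: a Hecke character `ψ` of `F` trivial on the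
norm group is `η^i` for some `i < ℓ`. Proof: `[𝕀_F : F^× N 𝕀_E] = ℓ`
(`index_normGroup_eq_finrank_of_isCyclic`, the idelic norm index computation of the tree), so the
quotient is cyclic of prime order, generated by the class of any idele `g ∉ F^× N 𝕀_E`; `η(g)` is
a primitive `ℓ`-th root of unity (`η` vanishes *exactly* on the norm group), `ψ(g)` is an `ℓ`-th
root of unity, so `ψ(g) = η(g)^i`, and `ψ = η^i` on `g^ℤ · F^× N 𝕀_E = 𝕀_F`. (Arthur–Clozel, Ch. 3
§4: for `ℓ` prime the characters of `𝔸^*/F^* N(𝔸_E^*) ≅ Gal(E/F)` are the powers of `η`; used in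
the proof of Thm. 4.2 (d), p. 204, "all such `π` are of the form `π ⊗ η^i`".)
[cite: ArthurClozelAMS120, Ch. 3, §4 (Thm. 4.2 (d), proof)] -/
theorem _root_.Literature.NumberTheory.GaloisRepresentations.HeckeCharacter.IsClassFieldCharacter.exists_eq_pow_of_isTrivialOnNormGroup
    [IsGalois F E]
    (hℓ : (Module.finrank F E).Prime) {η ψ : HeckeCharacter F} (hη : η.IsClassFieldCharacter E)
    (hψ : ψ.IsTrivialOnNormGroup E) : ∃ i < Module.finrank F E, ψ = η ^ i := by
  classical
  haveI : Fact (Module.finrank F E).Prime := ⟨hℓ⟩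
  haveI : NeZero (Module.finrank F E) := ⟨hℓ.ne_zero⟩
  haveI : IsCyclic (E ≃ₐ[F] E) := isCyclic_of_prime_card (IsGalois.card_aut_eq_finrank F E)
  have hidx : (normGroup F E).index = Module.finrank F E :=
    index_normGroup_eq_finrank_of_isCyclic (F := F) (E := E)
  -- an idele outside the norm group; its `ℓ`-th power is inside
  obtain ⟨g, hg⟩ := exists_not_mem_normGroup (F := F) (E := E) hℓ.one_lt
  have hgℓ : g ^ Module.finrank F E ∈ normGroup F E := by
    rw [← hidx]; exact Subgroup.pow_index_mem (normGroup F E) g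
  -- `η g` is a primitive `ℓ`-th root of unity, `ψ g` an `ℓ`-th root of unity
  have hζℓ : ((η g : ℂˣ) : ℂ) ^ Module.finrank F E = 1 := by
    rw [← Units.val_pow_eq_pow_val, ← map_pow, (hη _).2 hgℓ, Units.val_one]
  have hζ1 : ((η g : ℂˣ) : ℂ) ≠ 1 := fun h1 => hg ((hη g).1 (Units.val_eq_one.1 h1))
  have hprim : IsPrimitiveRoot ((η g : ℂˣ) : ℂ) (Module.finrank F E) := by
    have h := IsPrimitiveRoot.orderOf ((η g : ℂˣ) : ℂ)
    rwa [orderOf_eq_prime hζℓ hζ1] at h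
  have hψℓ : ((ψ g : ℂˣ) : ℂ) ^ Module.finrank F E = 1 := by
    rw [← Units.val_pow_eq_pow_val, ← map_pow, hψ _ hgℓ, Units.val_one]
  obtain ⟨i, hi, hiψ⟩ := hprim.eq_pow_of_pow_eq_one hψℓ
  have hψg : ψ g = (η ^ i) g := by
    rw [HeckeCharacter.pow_apply]
    exact Units.ext (by rw [Units.val_pow_eq_pow_val, hiψ])
  refine ⟨i, hi, HeckeCharacter.ext fun x => ?_⟩
  -- `x = g ^ k · m` with `m` in the norm group (the quotient is cyclic of prime order)
  have hg1 : (g : ideleGroup F ⧸ normGroup F E) ≠ 1 := by rwa [Ne, QuotientGroup.eq_one_iff]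
  have hcard : Nat.card (ideleGroup F ⧸ normGroup F E) = Module.finrank F E := hidx
  have hzp : Subgroup.zpowers (g : ideleGroup F ⧸ normGroup F E) = ⊤ :=
    zpowers_eq_top_of_prime_card hcard hg1
  have hx : (x : ideleGroup F ⧸ normGroup F E) ∈ Subgroup.zpowers (g : ideleGroup F ⧸ normGroup F E) := by
    rw [hzp]; exact Subgroup.mem_top _
  obtain ⟨k, hk⟩ := Subgroup.mem_zpowers_iff.1 hx
  have hm : (g ^ k)⁻¹ * x ∈ normGroup F E := by
    rw [← QuotientGroup.eq, QuotientGroup.mk_zpow]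
    exact hk
  have e1 : ψ x = ψ (g ^ k) * ψ ((g ^ k)⁻¹ * x) := by rw [← map_mul, mul_inv_cancel_left]
  have e2 : (η ^ i) x = (η ^ i) (g ^ k) * (η ^ i) ((g ^ k)⁻¹ * x) := by
    rw [← map_mul, mul_inv_cancel_left]
  rw [e1, e2, hψ _ hm, (hη.pow_isTrivialOnNormGroup i) _ hm, map_zpow, map_zpow, hψg]

end NormGroupCharacters

/-! ### Arthur–Clozel, Ch. 3, Thm. 4.2 (d) for `GL(1)`, unconditionally -/

section RankOneFull

variable {F E : Type} [Field F] [NumberField F] [Field E] [NumberField E] [Algebra F E]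

/-- **Arthur–Clozel, Ch. 3, Thm. 4.2 (d) in rank `n = 1` — all three clauses, unconditionally.**
The named fact `ArthurClozel1989_cuspidal_descent 1 F E`: for `E/F` Galois of prime degree `ℓ`
with a class-field character `η`, and `Π` a `Gal(E/F)`-stable cuspidal automorphic representation
of `GL_1(𝔸_E)`: (1) `Π` is the weak base-change lift of a cuspidal `π` on `GL_1(𝔸_F)`
(`ArthurClozel1989_exists_cuspidal_descent_of_isGalStable.rank_one`: descent of `Gal`-invariant
idele class characters, class field theory); (2) `π ⊗ η ≠ π` — in rank one
`χ_{π ⊗ η} = η χ_π` (`heckeCharacter_twistByFiniteOrderChar`) and `η ≠ 1`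
(`[𝕀_F : F^× N 𝕀_E] = ℓ > 1`); (3) every cuspidal `π'` lifting to `Π` is `π ⊗ η^i`: by (1.1)
read on characters (`heckeCharacter_eq_baseChange_of_isWeakBaseChangeLift`)
`χ_{π'} ∘ N = χ_Π = χ_π ∘ N`, so `ψ = χ_{π'} χ_π⁻¹` is trivial on `F^× N(𝔸_E^×)`, hence `ψ = η^i`
(`IsClassFieldCharacter.exists_eq_pow_of_isTrivialOnNormGroup`), and `π' = π ⊗ η^i` by
multiplicity one for `GL_1` (`CuspidalAutomorphicRepGL.eq_of_heckeCharacter_eq`, proved by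
ergodicity). In print (p. 204) clauses (2), (3) for general `n` come from the pole of
`L^S(s, Π × Π̃) = ∏_i L^S(s, π ⊗ π̃ ⊗ η^i)` and Thm. 3.1; in rank one Thm. 3.1 *is* the statement
that the characters of `𝔸^*/F^* N(𝔸_E^*)` are the `η^i`, which is the road taken here, so that no
analytic input (Hecke–Tate continuation of `L(s, χ)`) is needed.
[cite: ArthurClozelAMS120, Ch. 3, Thm. 4.2 (d)] -/
theorem arthurClozel1989_cuspidal_descent_one [FiniteDimensional F E] :
    ArthurClozel1989_cuspidal_descent 1 F E := by
  intro _ _ hℓ η hη ν _ hν Q hQ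
  classical
  haveI : Fact (Module.finrank F E).Prime := ⟨hℓ⟩
  haveI : IsCyclic (E ≃ₐ[F] E) := isCyclic_of_prime_card (IsGalois.card_aut_eq_finrank F E)
  obtain ⟨μ, hμ, P, hP⟩ :=
    ArthurClozel1989_exists_cuspidal_descent_of_isGalStable.rank_one hℓ ν hν Q hQ
  haveI := hμ
  have hQP : Q.heckeCharacter = P.heckeCharacter.baseChange E :=
    CuspidalAutomorphicRepGL.heckeCharacter_eq_baseChange_of_isWeakBaseChangeLift hP
  refine ⟨μ, hμ, P, hP, fun heq => ?_, fun P' hP' => ?_⟩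
  · -- (2) `π ⊗ η ≠ π`: `η χ_π = χ_π` would force `η = 1`
    have h1 := congrArg CuspidalAutomorphicRepGL.heckeCharacter heq
    rw [CuspidalAutomorphicRepGL.heckeCharacter_twistByFiniteOrderChar] at h1
    have hη1 : η = 1 := mul_right_cancel (h1.trans (one_mul P.heckeCharacter).symm)
    obtain ⟨x, hx⟩ := exists_not_mem_normGroup (F := F) (E := E) hℓ.one_lt
    exact hη.ne_one hx hη1
  · -- (3) `π' = π ⊗ η^i`
    have hQP' : Q.heckeCharacter = P'.heckeCharacter.baseChange E :=
      CuspidalAutomorphicRepGL.heckeCharacter_eq_baseChange_of_isWeakBaseChangeLift hP'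
    have hψ : (P'.heckeCharacter * P.heckeCharacter⁻¹).IsTrivialOnNormGroup E := by
      refine ((P'.heckeCharacter * P.heckeCharacter⁻¹).isTrivialOnNormGroup_iff_forall_ideleRelNorm
        E).2 fun y => ?_
      have h1 : P'.heckeCharacter (AdeleRing.ideleRelNorm F E y) =
          P.heckeCharacter (AdeleRing.ideleRelNorm F E y) := by
        rw [← HeckeCharacter.baseChange_apply, ← HeckeCharacter.baseChange_apply, ← hQP, ← hQP']
      rw [HeckeCharacter.mul_apply, HeckeCharacter.inv_apply, h1, mul_inv_cancel]
    obtain ⟨i, -, hψi⟩ := hη.exists_eq_pow_of_isTrivialOnNormGroup hℓ hψ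
    refine ⟨i, CuspidalAutomorphicRepGL.eq_of_heckeCharacter_eq ?_⟩
    rw [CuspidalAutomorphicRepGL.heckeCharacter_twistByFiniteOrderChar, ← hψi, inv_mul_cancel_right]

/-- **Thm. 4.2 (d) for `GL(1)` in the `η`-free packaging of `ArthurClozelCuspidalDescentAssembly`**
(any Hecke character `η` of finite order whose values `η(ϖ_v)` are primitive `f_v`-th roots of
unity for almost all `v` — e.g. a class-field character): existence, `π ⊗ η ≠ π`, and "every
cuspidal descent is `π ⊗ η^i`, `i < [E:F]`", from (2.2) for `GL_1` over `F` only (Hecke–Tate), the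
other inputs of `arthurClozel1989_cuspidal_descent_of_exists_of_character` being theorems in rank
one: (2.1) (`JacquetShalika1981_multipliable_partialPairL_holds`), (2.3)
(`JacquetShalika1981_partialPairL_pole_of_eq_conj_one`: the pole of the partial Dedekind zeta
function) and multiplicity one (`multiplicity_one_gl_one`). [cite: ArthurClozelAMS120, Ch. 3, Thm. 4.2 (d)] -/
theorem arthurClozel1989_cuspidal_descent_one_of_character [IsGalois F E]
    (h22F : ∀ (μ : Measure (gl 1 F).automorphicQuotient) [(gl 1 F).IsAutomorphicMeasure μ],
      JacquetShalika1981_partialPairL_at_one_of_ne_conj (n := 1) (K := F) (μ := μ))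
    (hℓ : (Module.finrank F E).Prime) {η : HeckeCharacter F} (hη : η.IsFiniteOrder)
    (hζ : ∀ᶠ v : HeightOneSpectrum (𝓞 F) in cofinite,
      IsPrimitiveRoot (η.valueAtUniformizer v) (v.asIdeal.inertiaDegIn (𝓞 E)))
    {ν : Measure (gl 1 E).automorphicQuotient} [(gl 1 E).IsAutomorphicMeasure ν]
    (hν : IsGalInvariant F ν) (Q : CuspidalAutomorphicRepGL 1 E ν)
    (hQ : ∀ σ : E ≃ₐ[F] E, Q.IsGalStable F hν σ) :
    ∃ (μ : Measure (gl 1 F).automorphicQuotient) (_ : (gl 1 F).IsAutomorphicMeasure μ)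
      (P : CuspidalAutomorphicRepGL 1 F μ),
      IsWeakBaseChangeLift P.1 Q.1 ∧ P.twistByFiniteOrderChar η hη ≠ P ∧
        ∀ P' : CuspidalAutomorphicRepGL 1 F μ, IsWeakBaseChangeLift P'.1 Q.1 →
          ∃ i < Module.finrank F E,
            P' = P.twistByFiniteOrderChar (η ^ i) (isFiniteOrder_pow hη i) :=
  arthurClozel1989_cuspidal_descent_of_exists_of_character
    ArthurClozel1989_exists_cuspidal_descent_of_isGalStable.rank_one
    (fun _ _ => JacquetShalika1981_multipliable_partialPairL_holds) h22F
    (fun _ _ => JacquetShalika1981_partialPairL_pole_of_eq_conj_one)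
    (fun μ _ => multiplicity_one_gl_one F μ) JacquetShalika1981_multipliable_partialPairL_holds
    JacquetShalika1981_partialPairL_pole_of_eq_conj_one Nat.one_pos hℓ hη hζ hν Q hQ

end RankOneFull

/-! ### Thm. 4.2 (b) and Thm. 3.1 for `GL(1)` -/

section RankOneSiblings

variable {F E : Type} [Field F] [NumberField F] [Field E] [NumberField E] [Algebra F E]

/-- **No cuspidal `π` on `GL_1` is fixed by the twist with a class-field character**: for `E/F`
Galois of prime degree and `η` a class-field character, `π ⊗ η ≠ π` — `χ_{π ⊗ η} = η χ_π`
(`heckeCharacter_twistByFiniteOrderChar`) and `η ≠ 1` (`[𝕀_F : F^× N 𝕀_E] = [E:F] > 1`,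
`exists_not_mem_normGroup`). So the hypothesis "`π ≅ π ⊗ η`" of Thm. 4.2 (b) is void in rank one,
in accordance with its conclusion `ℓ ∣ n`. [cite: ArthurClozelAMS120, Ch. 3, Thm. 4.2 (b)] -/
theorem CuspidalAutomorphicRepGL.twistByFiniteOrderChar_ne_of_isClassFieldCharacter_one [IsGalois F E]
    (hℓ : (Module.finrank F E).Prime) {η : HeckeCharacter F} (hη : η.IsClassFieldCharacter E)
    {μ : Measure (gl 1 F).automorphicQuotient} [(gl 1 F).IsAutomorphicMeasure μ]
    (P : CuspidalAutomorphicRepGL 1 F μ) : P.twistByFiniteOrderChar η hη.isFiniteOrder ≠ P := by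
  intro heq
  haveI : Fact (Module.finrank F E).Prime := ⟨hℓ⟩
  haveI : IsCyclic (E ≃ₐ[F] E) := isCyclic_of_prime_card (IsGalois.card_aut_eq_finrank F E)
  have h1 := congrArg CuspidalAutomorphicRepGL.heckeCharacter heq
  rw [CuspidalAutomorphicRepGL.heckeCharacter_twistByFiniteOrderChar] at h1
  have hη1 : η = 1 := mul_right_cancel (h1.trans (one_mul P.heckeCharacter).symm)
  obtain ⟨x, hx⟩ := exists_not_mem_normGroup (F := F) (E := E) hℓ.one_lt
  exact hη.ne_one hx hη1

variable (F E) in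
/-- **Arthur–Clozel, Ch. 3, Thm. 4.2 (b) for `n = 1`** (the rendering
`ArthurClozel1989_inducedLift_of_twist_eq 1 F E` at the level of (1.1)): vacuously true, its
hypothesis `π ⊗ η = π` being impossible for cuspidal `π` on `GL_1`
(`twistByFiniteOrderChar_ne_of_isClassFieldCharacter_one`). [cite: ArthurClozelAMS120, Ch. 3, Thm. 4.2 (b)] -/
theorem arthurClozel1989_inducedLift_of_twist_eq_one [FiniteDimensional F E] :
    ArthurClozel1989_inducedLift_of_twist_eq 1 F E := by
  intro _ _ hℓ η hη μ _ P hP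
  exact absurd hP (P.twistByFiniteOrderChar_ne_of_isClassFieldCharacter_one hℓ hη)

variable (F E) in
/-- **Arthur–Clozel, Ch. 3, Thm. 4.2 (b), divisibility clause, for `n = 1`**
(`ArthurClozel1989_dvd_of_twist_eq 1 F E`): vacuously true in rank one.
[cite: ArthurClozelAMS120, Ch. 3, Thm. 4.2 (b)] -/
theorem arthurClozel1989_dvd_of_twist_eq_one [FiniteDimensional F E] :
    ArthurClozel1989_dvd_of_twist_eq 1 F E :=
  ArthurClozel1989_dvd_of_twist_eq_of_inducedLift 1 F E (arthurClozel1989_inducedLift_of_twist_eq_one F E)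

/-- In rank one a level `K(𝔫)` with a non-zero fixed vector in the irreducible `W ≤ L²(GL_1)` acts
trivially on all of `W` (`R(k)` is the scalar `ω_W(k)`, and `ω_W(k) f = f` with `f ≠ 0`). [folklore] -/
theorem GLOne.eigenvalue_eq_one_of_hasSatakeParameterAt {K : Type} [Field K] [NumberField K]
    {μ : Measure (gl 1 K).automorphicQuotient} [(gl 1 K).IsAutomorphicMeasure μ]
    {W : ContRepresentation.ClosedSubrep ((gl 1 K).rightRegular μ)} (hW : W.toContRep.IsTopIrreducible)
    {Kf : Subgroup (GL (Fin 1) (AdeleRing (𝓞 K) K))} {v : HeightOneSpectrum (𝓞 K)}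
    {ϖ : (v.adicCompletion K)ˣ} {α : Multiset ℂ} (h : HasSatakeParameterAt W Kf v ϖ α) :
    ∀ k ∈ Kf, GLOne.eigenvalue hW k = 1 := by
  obtain ⟨-, -, f, hfK, hf0, -⟩ := h
  rw [ContRepresentation.ClosedSubrep.mem_fixedVectors] at hfK
  exact fun k hk => GLOne.eigenvalue_eq_one_of_apply_eq hW hf0 (hfK k hk)

/-- **Arthur–Clozel, Ch. 3, Thm. 3.1 (fibres of global base change) for `n = 1`, unconditionally,
for `E/F` cyclic of any degree** (the named fact `ArthurClozel1989_fibres_of_baseChange (n := 1)`):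
if the cuspidal `π, π' ≤ L²_cusp(GL_1(𝔸_F))` satisfy `(t_{π',v})^{f_v} = (t_{π,v})^{f_v}` for
almost all `v`, then `π' = π ⊗ χ` for a Hecke character `χ` trivial on `F^× N(𝔸_E^×)`. Proof (the
rank-one content of the printed argument, p. 201, with the `L`-functions replaced by class field
theory in the elementary form `χ` trivial on norms ⟺ `χ ∘ N_{E/F} = 1`): `ψ = χ_{π'} χ_π⁻¹` has
`ψ(ϖ_v)^{f_v} = 1` for almost all `v` (`t_{π,v} = {χ_π(ϖ_v)}`,
`GLOne.hasSatakeParameterAt_singleton`), hence `(ψ ∘ N_{E/F})(ϖ_w) = ψ(ϖ_v)^{f(w|v)} = 1` at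
almost all `w` (`HeckeCharacter.baseChange_localUnits`), so `ψ ∘ N_{E/F} = 1` by rigidity
(`HeckeCharacter.eq_one_of_eventually_valueAtUniformizer_eq_one`, Cassels–Fröhlich VII Prop. 4.1),
i.e. `ψ` is trivial on the norm group (`isTrivialOnNormGroup_iff_baseChange_eq_one`); and
`π' = π ⊗ ψ` by `χ_{π ⊗ ψ} = ψ χ_π = χ_{π'}` and multiplicity one for `GL_1`
(`CuspidalAutomorphicRepGL.eq_of_heckeCharacter_eq`; the hypothesis `multiplicity_one_gl` is not
used). [cite: ArthurClozelAMS120, Ch. 3, Thm. 3.1] -/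
theorem arthurClozel1989_fibres_of_baseChange_one :
    ArthurClozel1989_fibres_of_baseChange (n := 1) (F := F) (E := E) := by
  intro _ _ μ _ _ P P' 𝔫 𝔫' h h₀ h₀'
  classical
  set ψ : HeckeCharacter F := P'.heckeCharacter * P.heckeCharacter⁻¹ with hψdef
  -- `ψ(ϖ_v)^{f_v} = 1` for almost all `v`
  have hpow : ∀ᶠ v : HeightOneSpectrum (𝓞 F) in cofinite,
      ((ψ (localUnits v (HeckeCharacter.uniformizer F v)) : ℂˣ) : ℂ) ^
        v.asIdeal.inertiaDegIn (𝓞 E) = 1 := by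
    filter_upwards [h, h₀, h₀'] with v hv h0v h0v'
    -- the levels act trivially on `π`, `π'` (a non-zero fixed vector exists)
    obtain ⟨ϖ₀, α₀, hα₀⟩ := h0v
    obtain ⟨ϖ₀', α₀', hα₀'⟩ := h0v'
    have hK := GLOne.eigenvalue_eq_one_of_hasSatakeParameterAt P.isTopIrreducible hα₀
    have hK' := GLOne.eigenvalue_eq_one_of_hasSatakeParameterAt P'.isTopIrreducible hα₀'
    have hϖ := HeckeCharacter.valued_uniformizer (K := F) v
    have hrel := hv _ _ _ (GLOne.hasSatakeParameterAt_singleton P.isTopIrreducible hK v hϖ)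
      (GLOne.hasSatakeParameterAt_singleton P'.isTopIrreducible hK' v hϖ)
    rw [Multiset.map_singleton, Multiset.map_singleton, Multiset.singleton_inj] at hrel
    have hne : ((GLOne.heckeCharacter P.isTopIrreducible
        (localUnits v (HeckeCharacter.uniformizer F v)) : ℂˣ) : ℂ) ^
          v.asIdeal.inertiaDegIn (𝓞 E) ≠ 0 := pow_ne_zero _ (Units.ne_zero _)
    rw [hψdef, HeckeCharacter.mul_apply, HeckeCharacter.inv_apply, Units.val_mul,
      Units.val_inv_eq_inv_val, mul_pow, inv_pow]
    change ((GLOne.heckeCharacter P'.isTopIrreducible _ : ℂˣ) : ℂ) ^ _ *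
      (((GLOne.heckeCharacter P.isTopIrreducible _ : ℂˣ) : ℂ) ^ _)⁻¹ = 1
    rw [hrel, mul_inv_cancel₀ hne]
  -- hence `ψ ∘ N_{E/F} = 1`
  have hbc1 : ψ.baseChange E = 1 := by
    refine HeckeCharacter.eq_one_of_eventually_valueAtUniformizer_eq_one ?_
    have h2 := (tendsto_under_cofinite (B := 𝓞 E) (𝓞 F)).eventually hpow
    have hur : ∀ᶠ w : HeightOneSpectrum (𝓞 E) in cofinite, (ψ.baseChange E).IsUnramifiedAt w :=
      (ψ.baseChange E).finite_ramifiedPlaces_iff.1 (HeckeCharacter.finite_ramifiedPlaces_holds _)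
    filter_upwards [h2, eventually_ramificationIdx_eq_one F E, hur] with w hw2 hw4 huw
    haveI iw : w.asIdeal.LiesOver (w.under (𝓞 F)).asIdeal := ⟨rfl⟩
    obtain ⟨c, hc, -⟩ := exists_localUnitsAbove E (w.under (𝓞 F))
      (HeckeCharacter.uniformizer F (w.under (𝓞 F)))
    have he' : (w.under (𝓞 F)).asIdeal.ramificationIdx' w.asIdeal = 1 := by
      rw [Ideal.ramificationIdx'_eq_ramificationIdx (w.under (𝓞 F)).asIdeal w.asIdeal
        (w.under (𝓞 F)).ne_bot, hw4]
    have heIn : (w.under (𝓞 F)).asIdeal.ramificationIdxIn (𝓞 E) = 1 := by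
      rw [Ideal.ramificationIdxIn_eq_ramificationIdx (w.under (𝓞 F)).asIdeal w.asIdeal (E ≃ₐ[F] E),
        hw4]
    have hϖ' : Valued.v ((c w : (w.adicCompletion E)ˣ) : w.adicCompletion E) =
        WithZero.exp (-1 : ℤ) := by
      rw [hc w rfl, valued_adicCompletionOfLiesOver, he', pow_one, HeckeCharacter.valued_uniformizer]
    rw [← HeckeCharacter.localComponent_eq_valueAtUniformizer huw hϖ', HeckeCharacter.localComponent_apply,
      HeckeCharacter.baseChange_localUnits E ψ (w.under (𝓞 F)) _ c hc rfl, heIn, one_mul,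
      Units.val_pow_eq_pow_val, hw2]
  refine ⟨ψ, (ψ.isTrivialOnNormGroup_iff_baseChange_eq_one (E := E)).2 hbc1,
    CuspidalAutomorphicRepGL.eq_of_heckeCharacter_eq ?_⟩
  rw [CuspidalAutomorphicRepGL.heckeCharacter_twistByFiniteOrderChar, hψdef, inv_mul_cancel_right]

end RankOneSiblings

end Literature.NumberTheory.Automorphic
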